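import Summits.NavierStokesRegularity.FluidComputer.PalasekTowerLundgrenChildSwirlCeiling
import Mathlib.Analysis.Real.Pi.Bounds

/-!
# REGISTER v2.3″ (continued): the any-profile CEILINGS of a Lundgren-carried child core AS NUMBERS —
# `‖swirl(t)‖_∞ ≤ Γ (λA_k/(4π(1 − e^{−λA_k t})))^{1/2}` and `0 ≤ ω_z(t) ≤ Γ λA_k/(1 − e^{−λA_k t})`

Cell `ns-blowup`, seat `ns-blowup-ecbridge-8` (g8); evidence toward the UPPER half of crux 19250
`HeredityFromTwo` (`stub_window_ceiling` / `WindowCeilingAt`) of route `PalasekTowerBreakdown`, in the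
MODEL lane. Same MODEL IDENTIFICATION and hypotheses as `PalasekTowerLundgrenChildSwirlCeiling`
(«child core = cross-section of Lundgren's stretched flow in the host strain `c = λA_k` at `ν = 1`»,
co-signed axial vorticity at the hand-over, cross-section circulation `Γ`). That file's ceilings carry
Mathlib's unevaluated Gagliardo–Nirenberg constant `C_GNS` (`K = (2π)⁻¹((3π)^{3/4}((128/3)C_GNS³)^{1/4}+1)`,
`8 C_GNS`); this file reads the v4/v5 Literature chain with EXPLICIT constants instead —
`PlanarVorticityLpDecay` v5 (Nash's iteration at the explicit planar Nash constant `1/2` of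
`PlanarSobolevExplicitConstants`, lit3 g9: `‖ω̃(T)‖_∞ ≤ Γ/T`) and `BiotSavart2DSharpSupBound` (the SHARP
kinematic bound `‖K₂ ∗ ω̃‖_∞ ≤ (‖ω̃‖_∞ Γ/4π)^{1/2}`, Rankine-optimal) through Saffman §13.3 (29)
(`PlanarVelocityDecay` v4, `Lundgren.…_sharp` / `…_explicit`):

* `palasekTowerBreakdown_childSwirl_le_of_circulation_anyProfile_sharp` — for `t > 0` in the window and
  every `y`: **`‖swirl(t, y)‖ ≤ Γ (λA_k / (4π (1 − e^{−λA_k t})))^{1/2}`**;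
* `palasekTowerBreakdown_childSwirl_le_after_one_strain_time_anyProfile_sharp` — once `λA_k t ≥ 1`:
  **`‖swirl(t, y)‖ ≤ (63/50) Γ (λA_k/4π)^{1/2} ≤ 0.3556 · Γ (λA_k)^{1/2}`** (`(1 − e^{−1})^{−1/2} < 63/50`,
  `(4π)^{−1/2} < 0.2822`);
* `palasekTowerBreakdown_childPeak_le_of_circulation_anyProfile_explicit` — for `t > 0`, every `x ∈ ℝ³`:
  **`0 ≤ ω_z(t, x) ≤ Γ λA_k / (1 − e^{−λA_k t})`**;
* `palasekTowerBreakdown_childPeak_le_after_one_strain_time_anyProfile_explicit` — once `λA_k t ≥ 1`: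
  **`ω_z(t, x) ≤ (63/50)² Γ λA_k = 1.5876 Γ λA_k`**.

READING (numbers, not adjectives; `S(t)` = max swirl speed, `P(t)` = peak axial vorticity of the child,
in units `Γ(λA_k)^{1/2}` resp. `ΓλA_k`, after `O(1)` strain times of a window of `≈ 61.7–75`):
ANY co-signed profile — `S ∈ [0.0398 ρ^{−1/2}, 0.3556]` (floor after the N-2′ compaction budget,
`_childSwirl_floor_of_budget_anyProfile`; ceiling this file), `P ∈ [0.0398/ρ, 1.5876]`
(`_childPeak_floor_of_budget_anyProfile`; this file); RADIAL profiles (ecbridge-8 g7,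
`PalasekTowerRadialChildRelaxation`) — `S ∈ [0.0487, 0.0626]`, `P ∈ [(1−ε), (63/50)²(1+ε)]/(4π)` after the
relaxation clock; the Burgers vortex itself — `S = 0.0508`, `P = 1/(4π) = 0.0796`. The any-profile swirl
ceiling was `(63/50)·K(C_GNS)` (no number) before this generation; the kinematic step now carries the same
constant `(4π)^{−1/2}` as the radial class, the remaining factor `4π` in `P` is Nash's iteration versus
the (untyped, logarithmic-Sobolev) Carlen–Loss optimum.

WHAT THIS IS NOT: not NS about any registered flow — exact INFINITE-ENERGY Lundgren flows, no registered
stage; nothing is asserted about `AprioriCeiling`, `WindowCeilingAt`, `ReadoutFloors` or any crux; the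
identification «child core = Lundgren cross-section» is a MODEL step.

References: Th. Gallay, C. E. Wayne, Comm. Math. Phys. 255 (2005), Thm. 1.1 (1.2)
[cite: GallayWayne2005, Thm. 1.1 eq. (1.2)]; D. Iftimie, T. C. Sideris, P. Gamblin, Comm. PDE 24
(1999), Lemma 2.1 [cite: IftimieSiderisGamblin1999, Lemma 2.1]; P. G. Saffman, *Vortex Dynamics*, CUP
1992, §13.3 (26)–(31) [cite: Saffman1992, §13.3 eqs. (26)–(31)]; S. Palasek, arXiv:2605.13827, §3 (3.2)
[cite: Palasek2026ElementaryModel, §3 (3.2)].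
-/

namespace Summit.NavierStokesRegularity.FluidComputer.PalasekTowerClayBridge

open Real Set MeasureTheory
open Literature.Analysis.FluidPDE Literature.Analysis.FluidPDE.Lundgren

variable {S S' : Set ℝ}
  {v : ℝ → EuclideanSpace ℝ (Fin 2) → EuclideanSpace ℝ (Fin 2)}
  {q : ℝ → EuclideanSpace ℝ (Fin 2) → ℝ} {w : ℝ → EuclideanSpace ℝ (Fin 2) → ℝ}

/-- **THE CHILD'S SWIRL-SPEED CEILING AS A NUMBER, FOR ANY PROFILE, UNIFORM IN TIME** (`ν = 1`, host
strain `λA_k`; setting of `_childSwirl_le_of_circulation_anyProfile`): for a co-signed child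
(`ω_z(0, ·) ≥ 0` on `ℝ³`) with cross-section circulation `Γ = ∫ ω_z(0, ιy + z₀e_z) dy`, at every later
time `t > 0` of `S` and every `y`,
**`‖e^{ct/2} ṽ(T(t), e^{ct/2} y)‖ ≤ Γ · (λA_k / (4π (1 − e^{−λA_k t})))^{1/2}`** (`c = λA_k`,
`T(t) = (e^{ct} − 1)/c`) — `Lundgren.norm_swirl_lundgren_const_le_of_circulation_sharp` at `ν = 1`
(explicit planar peak bound `‖ω̃(T)‖_∞ ≤ Γ/T` + the sharp kinematic bound `(‖ω̃‖_∞Γ/4π)^{1/2}` +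
Saffman (29)). -/
theorem palasekTowerBreakdown_childSwirl_le_of_circulation_anyProfile_sharp (R : TowerRates) (k : ℕ)
    {l : ℝ} (hl : 0 < l) (hS' : Convex ℝ S') (hv : IsClassicalNSSolutionOn S' 1 0 v q)
    (hω : HasUniformRapidDecayOn S' (fun σ η => PlanarEigenmode.vorticity (v σ) η))
    (hBS : ∀ σ ∈ S', ∀ η, v σ η = biotSavart2D (PlanarEigenmode.vorticity (v σ)) η)
    (hw : IsSmoothSpaceTimeOn S' w)
    (hmaps : MapsTo (fun t => (exp (l * R.A k * t) - 1) / (l * R.A k)) S S') (h0 : (0 : ℝ) ∈ S)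
    {t : ℝ} (ht : t ∈ S) (ht0 : 0 < t) (z₀ : ℝ)
    (hpos : ∀ x : EuclideanSpace ℝ (Fin 3), 0 ≤ curl (velocity (fun _ => l * R.A k)
          (fun t y => exp (l * R.A k * t / 2) •
            v ((exp (l * R.A k * t) - 1) / (l * R.A k)) (exp (l * R.A k * t / 2) • y))
          (fun t y => exp (-(l * R.A k * t)) •
            w ((exp (l * R.A k * t) - 1) / (l * R.A k)) (exp (l * R.A k * t / 2) • y)) 0) x 2)
    (y : EuclideanSpace ℝ (Fin 2)) :
    ‖exp (l * R.A k * t / 2) • v ((exp (l * R.A k * t) - 1) / (l * R.A k)) (exp (l * R.A k * t / 2) • y)‖ ≤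
      (∫ y' : EuclideanSpace ℝ (Fin 2), curl (velocity (fun _ => l * R.A k)
          (fun t y => exp (l * R.A k * t / 2) •
            v ((exp (l * R.A k * t) - 1) / (l * R.A k)) (exp (l * R.A k * t / 2) • y))
          (fun t y => exp (-(l * R.A k * t)) •
            w ((exp (l * R.A k * t) - 1) / (l * R.A k)) (exp (l * R.A k * t / 2) • y)) 0)
          (embedXY y' + z₀ • eZ) 2) *
        Real.sqrt (l * R.A k / (4 * π * (1 - exp (-(l * R.A k * t))))) := by
  have hγ : 0 < l * R.A k := mul_pos hl (R.A_pos k)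
  have h := norm_swirl_lundgren_const_le_of_circulation_sharp hγ hS' one_pos hv hω hBS hw hmaps h0 ht
    ht0 hpos z₀ y
  simpa only [mul_one, sub_zero] using h

/-- `(1 − e^{−x})⁻¹ ≤ (63/50)²` for `x ≥ 1` (`e^{−1} < 0.3678794412`). [folklore] -/
private theorem inv_one_sub_exp_neg_le' {x : ℝ} (hx : 1 ≤ x) :
    (1 - exp (-x))⁻¹ ≤ (63 / 50) ^ 2 := by
  have h1 : exp (-x) ≤ exp (-1) := exp_le_exp.2 (by linarith)
  have h2 : exp (-1) < 0.3678794412 := exp_neg_one_lt_d9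
  have hpos : 0 < 1 - exp (-x) := by linarith
  rw [inv_le_comm₀ hpos (by norm_num)]
  norm_num at h2 ⊢
  linarith

/-- `(4π)^{−1/2} < 0.2822` (`π > 3.141592`, `0.2822² · 4 · 3.141592 > 1`). [folklore] -/
private theorem inv_sqrt_four_pi_lt : (Real.sqrt (4 * π))⁻¹ < 0.2822 := by
  have hπ : 3.141592 < π := pi_gt_d6
  have h4π : 0 < 4 * π := by positivity
  have hs : 0 < Real.sqrt (4 * π) := Real.sqrt_pos.2 h4π
  rw [inv_lt_comm₀ hs (by norm_num)]
  -- `1/0.2822 < √(4π)` iff `(1/0.2822)² < 4π`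
  rw [show (0.2822 : ℝ)⁻¹ = Real.sqrt ((0.2822 : ℝ)⁻¹ ^ 2) by
    rw [Real.sqrt_sq (by norm_num)]]
  exact Real.sqrt_lt_sqrt (by positivity) (by nlinarith)

/-- **AFTER ONE STRAIN TIME THE SWIRL CEILING IS `(63/50)·Γ·(λA_k/4π)^{1/2} ≤ 0.3556·Γ·(λA_k)^{1/2}`**
(`ν = 1`; setting of `_childSwirl_le_of_circulation_anyProfile_sharp`): for `λA_k t ≥ 1` and every `y`,
`‖e^{ct/2} ṽ(T(t), e^{ct/2} y)‖ ≤ (63/50) Γ (λA_k/(4π))^{1/2}` and `≤ 0.3556 Γ (λA_k)^{1/2}` — the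
any-profile CEILING companion, now a number, of the floor `(8π)⁻¹ρ^{−1/2} Γ(λA_k)^{1/2} ≈ 0.0398ρ^{−1/2}·`
after the N-2′ budget (`_childSwirl_floor_of_budget_anyProfile`); the radial class sits in
`[0.0487, 0.0626]` (`PalasekTowerRadialChildRelaxation`), Burgers at `0.0508`. -/
theorem palasekTowerBreakdown_childSwirl_le_after_one_strain_time_anyProfile_sharp (R : TowerRates)
    (k : ℕ) {l : ℝ} (hl : 0 < l) (hS' : Convex ℝ S') (hv : IsClassicalNSSolutionOn S' 1 0 v q)
    (hω : HasUniformRapidDecayOn S' (fun σ η => PlanarEigenmode.vorticity (v σ) η))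
    (hBS : ∀ σ ∈ S', ∀ η, v σ η = biotSavart2D (PlanarEigenmode.vorticity (v σ)) η)
    (hw : IsSmoothSpaceTimeOn S' w)
    (hmaps : MapsTo (fun t => (exp (l * R.A k * t) - 1) / (l * R.A k)) S S') (h0 : (0 : ℝ) ∈ S)
    {t : ℝ} (ht : t ∈ S) (hstrain : 1 ≤ l * R.A k * t) (z₀ : ℝ)
    (hpos : ∀ x : EuclideanSpace ℝ (Fin 3), 0 ≤ curl (velocity (fun _ => l * R.A k)
          (fun t y => exp (l * R.A k * t / 2) •
            v ((exp (l * R.A k * t) - 1) / (l * R.A k)) (exp (l * R.A k * t / 2) • y))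
          (fun t y => exp (-(l * R.A k * t)) •
            w ((exp (l * R.A k * t) - 1) / (l * R.A k)) (exp (l * R.A k * t / 2) • y)) 0) x 2)
    (y : EuclideanSpace ℝ (Fin 2)) :
    ‖exp (l * R.A k * t / 2) • v ((exp (l * R.A k * t) - 1) / (l * R.A k)) (exp (l * R.A k * t / 2) • y)‖ ≤
      63 / 50 * (∫ y' : EuclideanSpace ℝ (Fin 2), curl (velocity (fun _ => l * R.A k)
          (fun t y => exp (l * R.A k * t / 2) •
            v ((exp (l * R.A k * t) - 1) / (l * R.A k)) (exp (l * R.A k * t / 2) • y))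
          (fun t y => exp (-(l * R.A k * t)) •
            w ((exp (l * R.A k * t) - 1) / (l * R.A k)) (exp (l * R.A k * t / 2) • y)) 0)
          (embedXY y' + z₀ • eZ) 2) * Real.sqrt (l * R.A k / (4 * π)) ∧
    ‖exp (l * R.A k * t / 2) • v ((exp (l * R.A k * t) - 1) / (l * R.A k)) (exp (l * R.A k * t / 2) • y)‖ ≤
      0.3556 * (∫ y' : EuclideanSpace ℝ (Fin 2), curl (velocity (fun _ => l * R.A k)
          (fun t y => exp (l * R.A k * t / 2) •
            v ((exp (l * R.A k * t) - 1) / (l * R.A k)) (exp (l * R.A k * t / 2) • y))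
          (fun t y => exp (-(l * R.A k * t)) •
            w ((exp (l * R.A k * t) - 1) / (l * R.A k)) (exp (l * R.A k * t / 2) • y)) 0)
          (embedXY y' + z₀ • eZ) 2) * Real.sqrt (l * R.A k) := by
  have hγ : 0 < l * R.A k := mul_pos hl (R.A_pos k)
  have hπ : 0 < π := pi_pos
  have ht0 : 0 < t := by
    by_contra hle
    have : l * R.A k * t ≤ 0 := mul_nonpos_of_nonneg_of_nonpos hγ.le (not_lt.1 hle)
    linarith
  have h := palasekTowerBreakdown_childSwirl_le_of_circulation_anyProfile_sharp R k hl hS' hv hω hBS hw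
    hmaps h0 ht ht0 z₀ hpos y
  -- abbreviate the circulation
  set Γ : ℝ := ∫ y' : EuclideanSpace ℝ (Fin 2), curl (velocity (fun _ => l * R.A k)
          (fun t y => exp (l * R.A k * t / 2) •
            v ((exp (l * R.A k * t) - 1) / (l * R.A k)) (exp (l * R.A k * t / 2) • y))
          (fun t y => exp (-(l * R.A k * t)) •
            w ((exp (l * R.A k * t) - 1) / (l * R.A k)) (exp (l * R.A k * t / 2) • y)) 0)
          (embedXY y' + z₀ • eZ) 2 with hΓ
  have hΓ0 : 0 ≤ Γ := integral_nonneg fun y' => hpos _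
  -- `(c/(4π(1 − e^{−ct})))^{1/2} ≤ (63/50) (c/4π)^{1/2}`
  have hexp : 0 < 1 - exp (-(l * R.A k * t)) := by
    have : exp (-(l * R.A k * t)) < 1 := exp_lt_one_iff.2 (by linarith)
    linarith
  have hle : l * R.A k / (4 * π * (1 - exp (-(l * R.A k * t)))) ≤ (63 / 50) ^ 2 * (l * R.A k / (4 * π)) := by
    rw [show l * R.A k / (4 * π * (1 - exp (-(l * R.A k * t)))) =
        (1 - exp (-(l * R.A k * t)))⁻¹ * (l * R.A k / (4 * π)) by field_simp]
    exact mul_le_mul_of_nonneg_right (inv_one_sub_exp_neg_le' hstrain) (by positivity)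
  have hsq : Real.sqrt (l * R.A k / (4 * π * (1 - exp (-(l * R.A k * t))))) ≤
      63 / 50 * Real.sqrt (l * R.A k / (4 * π)) := by
    calc Real.sqrt (l * R.A k / (4 * π * (1 - exp (-(l * R.A k * t)))))
        ≤ Real.sqrt ((63 / 50) ^ 2 * (l * R.A k / (4 * π))) := Real.sqrt_le_sqrt hle
      _ = 63 / 50 * Real.sqrt (l * R.A k / (4 * π)) := by
          rw [Real.sqrt_mul (by norm_num : (0 : ℝ) ≤ (63 / 50) ^ 2), Real.sqrt_sq (by norm_num)]
  have h1 : ‖exp (l * R.A k * t / 2) • v ((exp (l * R.A k * t) - 1) / (l * R.A k))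
      (exp (l * R.A k * t / 2) • y)‖ ≤ 63 / 50 * Γ * Real.sqrt (l * R.A k / (4 * π)) := by
    calc _ ≤ Γ * (63 / 50 * Real.sqrt (l * R.A k / (4 * π))) := h.trans (mul_le_mul_of_nonneg_left hsq hΓ0)
      _ = _ := by ring
  refine ⟨h1, h1.trans ?_⟩
  -- `(63/50) (4π)^{-1/2} ≤ 0.3556`
  have hroot : Real.sqrt (l * R.A k / (4 * π)) = Real.sqrt (l * R.A k) * (Real.sqrt (4 * π))⁻¹ := by
    rw [Real.sqrt_div' _ (by positivity : (0 : ℝ) ≤ 4 * π), div_eq_mul_inv]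
  have hnum : 63 / 50 * (Real.sqrt (4 * π))⁻¹ ≤ 0.3556 := by
    have := inv_sqrt_four_pi_lt
    nlinarith
  have hs0 : 0 ≤ Real.sqrt (l * R.A k) := Real.sqrt_nonneg _
  rw [hroot]
  calc 63 / 50 * Γ * (Real.sqrt (l * R.A k) * (Real.sqrt (4 * π))⁻¹)
      = (63 / 50 * (Real.sqrt (4 * π))⁻¹) * Γ * Real.sqrt (l * R.A k) := by ring
    _ ≤ 0.3556 * Γ * Real.sqrt (l * R.A k) := by
        have hGs : 0 ≤ Γ * Real.sqrt (l * R.A k) := mul_nonneg hΓ0 hs0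
        nlinarith

/-- **THE CHILD'S PEAK AXIAL VORTICITY CEILING AS A NUMBER, FOR ANY PROFILE, UNIFORM IN TIME**
(`ν = 1`, host strain `λA_k`; setting of `_childSwirl_le_of_circulation_anyProfile_sharp`): for a
co-signed child with cross-section circulation `Γ`, at every later time `t > 0` of `S` and every
`x ∈ ℝ³`, **`0 ≤ ω_z(t, x) ≤ Γ · λA_k / (1 − e^{−λA_k t})`** — the explicit planar peak bound
`0 ≤ ω̃(T) ≤ Γ/T` (`PlanarVorticityLpDecay` v5, Nash's iteration at the explicit constant) read through
Saffman (29) (`Lundgren.curl_lundgren_const_le_of_circulation_explicit`). The CEILING companion, now a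
number, of the floor `sup ω_z ≥ Γ·λA_k/(8πρ)` after the N-2′ budget (`_childPeak_floor_of_budget_anyProfile`);
Burgers' own peak is `Γ·λA_k/(4π)`. -/
theorem palasekTowerBreakdown_childPeak_le_of_circulation_anyProfile_explicit (R : TowerRates) (k : ℕ)
    {l : ℝ} (hl : 0 < l) (hS' : Convex ℝ S') (hv : IsClassicalNSSolutionOn S' 1 0 v q)
    (hω : HasUniformRapidDecayOn S' (fun σ η => PlanarEigenmode.vorticity (v σ) η))
    (hBS : ∀ σ ∈ S', ∀ η, v σ η = biotSavart2D (PlanarEigenmode.vorticity (v σ)) η)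
    (hw : IsSmoothSpaceTimeOn S' w)
    (hmaps : MapsTo (fun t => (exp (l * R.A k * t) - 1) / (l * R.A k)) S S') (h0 : (0 : ℝ) ∈ S)
    {t : ℝ} (ht : t ∈ S) (ht0 : 0 < t) (z₀ : ℝ)
    (hpos : ∀ x : EuclideanSpace ℝ (Fin 3), 0 ≤ curl (velocity (fun _ => l * R.A k)
          (fun t y => exp (l * R.A k * t / 2) •
            v ((exp (l * R.A k * t) - 1) / (l * R.A k)) (exp (l * R.A k * t / 2) • y))
          (fun t y => exp (-(l * R.A k * t)) •
            w ((exp (l * R.A k * t) - 1) / (l * R.A k)) (exp (l * R.A k * t / 2) • y)) 0) x 2)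
    (x : EuclideanSpace ℝ (Fin 3)) :
    0 ≤ curl (velocity (fun _ => l * R.A k)
          (fun t y => exp (l * R.A k * t / 2) •
            v ((exp (l * R.A k * t) - 1) / (l * R.A k)) (exp (l * R.A k * t / 2) • y))
          (fun t y => exp (-(l * R.A k * t)) •
            w ((exp (l * R.A k * t) - 1) / (l * R.A k)) (exp (l * R.A k * t / 2) • y)) t) x 2 ∧
      curl (velocity (fun _ => l * R.A k)
          (fun t y => exp (l * R.A k * t / 2) •
            v ((exp (l * R.A k * t) - 1) / (l * R.A k)) (exp (l * R.A k * t / 2) • y))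
          (fun t y => exp (-(l * R.A k * t)) •
            w ((exp (l * R.A k * t) - 1) / (l * R.A k)) (exp (l * R.A k * t / 2) • y)) t) x 2 ≤
        (∫ y' : EuclideanSpace ℝ (Fin 2), curl (velocity (fun _ => l * R.A k)
            (fun t y => exp (l * R.A k * t / 2) •
              v ((exp (l * R.A k * t) - 1) / (l * R.A k)) (exp (l * R.A k * t / 2) • y))
            (fun t y => exp (-(l * R.A k * t)) •
              w ((exp (l * R.A k * t) - 1) / (l * R.A k)) (exp (l * R.A k * t / 2) • y)) 0)
            (embedXY y' + z₀ • eZ) 2) *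
          (l * R.A k / (1 - exp (-(l * R.A k * t)))) := by
  have hγ : 0 < l * R.A k := mul_pos hl (R.A_pos k)
  have h := curl_lundgren_const_le_of_circulation_explicit hγ hS' one_pos hv hω hBS hw hmaps h0 ht ht0
    hpos z₀ x
  simpa only [one_mul, sub_zero] using h

/-- **AFTER ONE STRAIN TIME THE PEAK CEILING IS `(63/50)²·Γ·λA_k = 1.5876·Γ·λA_k`** (`ν = 1`;
setting of `_childPeak_le_of_circulation_anyProfile_explicit`): for `λA_k t ≥ 1` and every `x`,
`ω_z(t, x) ≤ (63/50)² Γ λA_k` (`(1 − e^{−1})⁻¹ ≤ (63/50)²`) — the Burgers peak scale `Γ·λA_k` up to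
`1.5876`, whatever the co-signed profile; the tree's floor after the N-2′ budget is `Γ·λA_k/(8πρ)`, the
radial class sits at `[(1−ε), (63/50)²(1+ε)]·Γ·λA_k/(4π)`, Burgers at `Γ·λA_k/(4π) = 0.0796·Γ·λA_k`. -/
theorem palasekTowerBreakdown_childPeak_le_after_one_strain_time_anyProfile_explicit (R : TowerRates)
    (k : ℕ) {l : ℝ} (hl : 0 < l) (hS' : Convex ℝ S') (hv : IsClassicalNSSolutionOn S' 1 0 v q)
    (hω : HasUniformRapidDecayOn S' (fun σ η => PlanarEigenmode.vorticity (v σ) η))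
    (hBS : ∀ σ ∈ S', ∀ η, v σ η = biotSavart2D (PlanarEigenmode.vorticity (v σ)) η)
    (hw : IsSmoothSpaceTimeOn S' w)
    (hmaps : MapsTo (fun t => (exp (l * R.A k * t) - 1) / (l * R.A k)) S S') (h0 : (0 : ℝ) ∈ S)
    {t : ℝ} (ht : t ∈ S) (hstrain : 1 ≤ l * R.A k * t) (z₀ : ℝ)
    (hpos : ∀ x : EuclideanSpace ℝ (Fin 3), 0 ≤ curl (velocity (fun _ => l * R.A k)
          (fun t y => exp (l * R.A k * t / 2) •
            v ((exp (l * R.A k * t) - 1) / (l * R.A k)) (exp (l * R.A k * t / 2) • y))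
          (fun t y => exp (-(l * R.A k * t)) •
            w ((exp (l * R.A k * t) - 1) / (l * R.A k)) (exp (l * R.A k * t / 2) • y)) 0) x 2)
    (x : EuclideanSpace ℝ (Fin 3)) :
    curl (velocity (fun _ => l * R.A k)
        (fun t y => exp (l * R.A k * t / 2) •
          v ((exp (l * R.A k * t) - 1) / (l * R.A k)) (exp (l * R.A k * t / 2) • y))
        (fun t y => exp (-(l * R.A k * t)) •
          w ((exp (l * R.A k * t) - 1) / (l * R.A k)) (exp (l * R.A k * t / 2) • y)) t) x 2 ≤
      (63 / 50) ^ 2 * (∫ y' : EuclideanSpace ℝ (Fin 2), curl (velocity (fun _ => l * R.A k)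
          (fun t y => exp (l * R.A k * t / 2) •
            v ((exp (l * R.A k * t) - 1) / (l * R.A k)) (exp (l * R.A k * t / 2) • y))
          (fun t y => exp (-(l * R.A k * t)) •
            w ((exp (l * R.A k * t) - 1) / (l * R.A k)) (exp (l * R.A k * t / 2) • y)) 0)
          (embedXY y' + z₀ • eZ) 2) * (l * R.A k) := by
  have hγ : 0 < l * R.A k := mul_pos hl (R.A_pos k)
  have ht0 : 0 < t := by
    by_contra hle
    have : l * R.A k * t ≤ 0 := mul_nonpos_of_nonneg_of_nonpos hγ.le (not_lt.1 hle)
    linarith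
  have h := palasekTowerBreakdown_childPeak_le_of_circulation_anyProfile_explicit R k hl hS' hv hω hBS hw
    hmaps h0 ht ht0 z₀ hpos x
  refine h.2.trans ?_
  set Γ : ℝ := ∫ y' : EuclideanSpace ℝ (Fin 2), curl (velocity (fun _ => l * R.A k)
          (fun t y => exp (l * R.A k * t / 2) •
            v ((exp (l * R.A k * t) - 1) / (l * R.A k)) (exp (l * R.A k * t / 2) • y))
          (fun t y => exp (-(l * R.A k * t)) •
            w ((exp (l * R.A k * t) - 1) / (l * R.A k)) (exp (l * R.A k * t / 2) • y)) 0)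
          (embedXY y' + z₀ • eZ) 2 with hΓ
  have hΓ0 : 0 ≤ Γ := integral_nonneg fun y' => hpos _
  have hfrac : l * R.A k / (1 - exp (-(l * R.A k * t))) ≤ (63 / 50) ^ 2 * (l * R.A k) := by
    rw [div_eq_mul_inv, mul_comm ((63 / 50 : ℝ) ^ 2)]
    exact mul_le_mul_of_nonneg_left (inv_one_sub_exp_neg_le' hstrain) hγ.le
  calc Γ * (l * R.A k / (1 - exp (-(l * R.A k * t)))) ≤ Γ * ((63 / 50) ^ 2 * (l * R.A k)) :=
        mul_le_mul_of_nonneg_left hfrac hΓ0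
    _ = _ := by ring

end Summit.NavierStokesRegularity.FluidComputer.PalasekTowerClayBridge
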